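import Literature.Probability.Percolation.SlabRSWExploration
import Literature.Probability.Percolation.SlabRSWTheorem314Case2
import HarnessLib

/-!
# Newman–Tassion–Wu 2017, Theorem 3.14 — Case 3 reduced to its gluing step (Lemma 3.16)

Topic: `Literature/Probability/Percolation`. The tree's assembly of NTW's RSW Theorem 3.14
(`NTW17.thm314_of_case3`, `SlabRSWTheorem314Case2.lean`) takes the Case-3 input `(H3)`:
`P[𝒜 ∩ 𝓑₁ᶜ ∩ 𝓑₂ᶜ] ≥ x ⇒ f(14n,13n) ≥ y(x)` eventually (NTW, p. 17, (3.47)–(3.52)). NTW prove it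
in two steps: the EXPLORATION of the set `𝒞` ((3.47)–(3.49): `P[𝒜 ∩ 𝓑₁ᶜ ∩ 𝓑₂ᶜ]` is at most the
largest probability, over the admissible values `C` of `𝒞`, of an open path from `Y` to `𝖡(R)`
inside `R ∖ C` — `SlabRSWExploration.lean`, `GlueData.real_case3_le`) and the GLUING step
(the topology of `γ ∪ γ'` and Lemma 3.16: such a path forces `𝒞_γ`, and `P[𝒞_γ] ≥ c₄/3`
gives `f(14n,13n) ≥ c₇`). This file performs the first step on the concrete event of Theorem 3.14
— transporting it to the reflected frame of `SlabRSWTheorem314Case2.lean` (`σ : x ↦ 7n - x`,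
`Q = (case2Setup n).Q`: `S' = [0,7n]×[0,8n-1] ⊆ R' = [0,14n]×[0,13n-1]`, `A = σX`,
`B = {7n}×[0,8n-1]`, `C = σY`) — and states what is left as the hypothesis `(H316)`:

* `preimage_reflect_case3` — `𝒜 ∩ 𝓑₁ᶜ ∩ 𝓑₂ᶜ` is the `σ`-preimage of
  `{B' ⟷^{S'} A} ∩ {𝖡 ⟷^{R'} C} ∩ {C ⟷^{R'} A}ᶜ ∩ ({A ⟷^{S'} B} ∩ {C̄ ⟷^{R̄'} 𝒩(Γ̄,ρ₂)})ᶜ`;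
* `real_case3_event_le` — hence `P[𝒜 ∩ 𝓑₁ᶜ ∩ 𝓑₂ᶜ] ≤ M` as soon as
  `P[C ⟷^{R' ∖ 𝒞(ω)} 𝖡] ≤ M` for every admissible lattice configuration `ω` of the reflected
  frame (`𝒞 = Q.explored k ρ₂`, NTW's explored set);
* **`thm314_hCase3_of`** — `(H3)` of `thm314_of_case3` FOLLOWS from
  `(H316)`: for every `x > 0` there are `y > 0`, `n₃` with: for `n ≥ n₃` and every admissible
  lattice configuration `ω`, `x ≤ P[C ⟷^{R' ∖ 𝒞(ω)} 𝖡]` implies `y ≤ f(14n, 13n)`;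
* `thm314_of_lemma316` — Theorem 3.14 assembled with Cases 2 AND the exploration discharged:
  (3.38) and `(H316)` give `inf_m f(2m,m) > 0`.

## Sources

* C. M. Newman, V. Tassion, W. Wu, *Critical percolation and the minimal spanning tree in slabs*,
  Comm. Pure Appl. Math. 70 (2017), arXiv:1512.09107: §3.5, proof of Theorem 3.14, Case 3
  ((3.47)–(3.52)) and Lemma 3.16 [NewmanTassionWu2017].
-/

noncomputable section

namespace Literature.Probability.Percolation

open MeasureTheory LatticeModels SimpleGraph

namespace NTW17

variable {k : ℕ}

/-! ## The Case-3 event in the reflected frame -/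

/-- `X ⟷^S Y` only depends on `Y ∩ S`: a connection to `Ȳ` inside `S̄` ends in `Ȳ ∩ S̄`.
[cite: NewmanTassionWu2017, §3.2 (the event A ↔^S B "connecting A ∩ S to B ∩ S")] -/
theorem slabConn_inter_right {S X Y : Set (ℤ × ℤ)} {ω : BondConfig (slab 3 k)}
    (h : ω ∈ slabConn k S X Y) : ω ∈ slabConn k S X {z | z ∈ S ∧ z ∈ Y} := by
  obtain ⟨x, hx, y, hy, hxy⟩ := h
  have hyS : y ∈ slabLift k S := (DCT16.pathIn_of_mem_openConnIn hxy).right_mem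
  exact ⟨x, hx, y, ⟨hyS, hy⟩, hxy⟩

/-- `σ S = S'`: the reflection `x ↦ 7n - x` maps `[0,7n]×[0,8n-1]` onto itself.
[cite: NewmanTassionWu2017, §3.5 (S)] -/
theorem image_reflect_S (n : ℕ) :
    planarReflect (7 * (n : ℤ)) '' boxR 0 (7 * n) 0 (8 * n - 1) = boxR 0 (7 * n) 0 (8 * n - 1) := by
  rw [image_planarReflect_eq]
  ext z
  simp only [Set.mem_setOf_eq, mem_boxR_iff]
  omega

/-- `σ 𝖫(S) = {x = 7n}`. [cite: NewmanTassionWu2017, §3.5 (L(S))] -/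
theorem image_reflect_L (n : ℕ) :
    planarReflect (7 * (n : ℤ)) '' {z : ℤ × ℤ | z.1 = 0} = ({z | z.1 = 7 * n} : Set (ℤ × ℤ)) := by
  rw [image_planarReflect_eq]
  ext z
  simp only [Set.mem_setOf_eq]
  omega

/-- `σ 𝖡 = 𝖡` (the bottom row is symmetric). [cite: NewmanTassionWu2017, §3.5 (B(R))] -/
theorem image_reflect_bottom (n : ℕ) :
    planarReflect (7 * (n : ℤ)) '' {z : ℤ × ℤ | z.2 = 0} = ({z | z.2 = 0} : Set (ℤ × ℤ)) := by
  rw [image_planarReflect_eq]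
  ext z
  simp only [Set.mem_setOf_eq]

/-- **`𝒜 ∩ 𝓑₁ᶜ ∩ 𝓑₂ᶜ` in the reflected frame**: it is the `σ`-preimage of
`{σ𝖫(S) ⟷^{S'} A} ∩ {𝖡 ⟷^{R'} C} ∩ {C ⟷^{R'} A}ᶜ ∩ ({A ⟷^{S'} B} ∩ {C̄ ⟷^{R̄'} 𝒩(Γ̄, ρ₂)})ᶜ`
for `Q = (case2Setup n).Q`. [cite: NewmanTassionWu2017, §3.5 (proof of Theorem 3.14, Case 3, the event 𝒜 ∩ 𝓑₁ᶜ ∩ 𝓑₂ᶜ)] -/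
theorem preimage_reflect_case3 {ρ₂ n : ℕ} (hn : 1 ≤ n) :
    (slabConn k (boxR 0 (7 * n) 0 (8 * n - 1)) {z | z.1 = 0} (sideSeg (7 * n) 0 (4 * n - 1)) ∩
        slabConn k (boxR (-(7 * n)) (7 * n) 0 (13 * n - 1)) {z | z.2 = 0} (sideSeg (7 * n) (5 * n) (13 * n - 1))) ∩
      (slabConn k (boxR (-(7 * n)) (7 * n) 0 (13 * n - 1)) (sideSeg (7 * n) (5 * n) (13 * n - 1))
        (sideSeg (7 * n) 0 (4 * n - 1)))ᶜ ∩ (evCase2 k ρ₂ n)ᶜ =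
    slabRelabel k (planarReflect (7 * (n : ℤ))) ⁻¹'
      ((slabConn k (case2Setup n hn).S {z | z.1 = 7 * n} (case2Setup n hn).A ∩
          slabConn k (case2Setup n hn).R {z | z.2 = 0} (case2Setup n hn).C) ∩
        ((case2Setup n hn).Q.evCA k)ᶜ ∩ ((case2Setup n hn).Q.evAB k ∩ (case2Setup n hn).Q.evNear k ρ₂)ᶜ) := by
  have hS : (case2Setup n hn).S = planarReflect (7 * (n : ℤ)) '' boxR 0 (7 * n) 0 (8 * n - 1) := by
    rw [case2Setup_S, image_reflect_S]
  have hR : (case2Setup n hn).R = planarReflect (7 * (n : ℤ)) '' boxR (-(7 * n)) (7 * n) 0 (13 * n - 1) := by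
    rw [case2Setup_R, ← image_reflect_R' n, image_planarReflect_image]
  have hA : (case2Setup n hn).A = planarReflect (7 * (n : ℤ)) '' sideSeg (7 * n) 0 (4 * n - 1) := by
    rw [case2Setup_A, ← image_reflect_A n, image_planarReflect_image]
  have hC : (case2Setup n hn).C = planarReflect (7 * (n : ℤ)) '' sideSeg (7 * n) (5 * n) (13 * n - 1) := by
    rw [case2Setup_C, ← image_reflect_C n, image_planarReflect_image]
  have e1 : slabRelabel k (planarReflect (7 * (n : ℤ))) ⁻¹'
      slabConn k (case2Setup n hn).S {z | z.1 = 7 * n} (case2Setup n hn).A =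
      slabConn k (boxR 0 (7 * n) 0 (8 * n - 1)) {z | z.1 = 0} (sideSeg (7 * n) 0 (4 * n - 1)) := by
    rw [hS, hA, ← image_reflect_L n]
    exact preimage_slabRelabel_slabConn k _ _ _ _
  have e2 : slabRelabel k (planarReflect (7 * (n : ℤ))) ⁻¹'
      slabConn k (case2Setup n hn).R {z | z.2 = 0} (case2Setup n hn).C =
      slabConn k (boxR (-(7 * n)) (7 * n) 0 (13 * n - 1)) {z | z.2 = 0} (sideSeg (7 * n) (5 * n) (13 * n - 1)) := by
    conv_lhs => rw [hR, hC, ← image_reflect_bottom n]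
    exact preimage_slabRelabel_slabConn k _ _ _ _
  have e3 : slabRelabel k (planarReflect (7 * (n : ℤ))) ⁻¹' (case2Setup n hn).Q.evCA k =
      slabConn k (boxR (-(7 * n)) (7 * n) 0 (13 * n - 1)) (sideSeg (7 * n) (5 * n) (13 * n - 1))
        (sideSeg (7 * n) 0 (4 * n - 1)) := by
    have hCA : (case2Setup n hn).Q.evCA k =
        slabConn k (case2Setup n hn).R (case2Setup n hn).C (case2Setup n hn).A := rfl
    rw [hCA, hR, hC, hA]
    exact preimage_slabRelabel_slabConn k _ _ _ _
  rw [Set.preimage_inter, Set.preimage_inter, Set.preimage_inter, Set.preimage_compl, Set.preimage_compl,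
    ← evCase2_eq hn, e1, e2, e3]

/-- **`P[𝒜 ∩ 𝓑₁ᶜ ∩ 𝓑₂ᶜ] ≤ M` from a bound on every admissible explored set** (NTW (3.49) for
the concrete event of Theorem 3.14): with `Q = (case2Setup n).Q` and `𝒞 = Q.explored k ρ₂`, if
`P[C ⟷^{R' ∖ 𝒞(ω)} 𝖡] ≤ M` for every lattice configuration `ω` with `A ⟷^{S'} B`,
`𝖡 ⟷^{R'} C`, not `C ⟷^{R'} A` and not `C̄ ⟷^{R̄'} 𝒩(Γ̄, ρ₂)`, then `P[𝒜 ∩ 𝓑₁ᶜ ∩ 𝓑₂ᶜ] ≤ M`.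
[cite: NewmanTassionWu2017, §3.5 (proof of Theorem 3.14, Case 3, (3.49))] -/
theorem real_case3_event_le {ρ₂ n : ℕ} (hn : 1 ≤ n) (p : unitInterval) {M : ℝ} (hM : 0 ≤ M)
    (hbound : ∀ ω : BondConfig (slab 3 k), ω ⊆ (slabGraph 3 k).edgeSet →
      ω ∈ (case2Setup n hn).Q.evAB k → ω ∈ slabConn k (case2Setup n hn).R {z | z.2 = 0} (case2Setup n hn).C →
      ω ∉ (case2Setup n hn).Q.evCA k → ω ∉ (case2Setup n hn).Q.evNear k ρ₂ →
      (bondPercolation (slabGraph 3 k) p).real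
        ((case2Setup n hn).Q.evOff k {z | z.2 = 0} ((case2Setup n hn).Q.explored k ρ₂ ω)) ≤ M) :
    (bondPercolation (slabGraph 3 k) p).real
      ((slabConn k (boxR 0 (7 * n) 0 (8 * n - 1)) {z | z.1 = 0} (sideSeg (7 * n) 0 (4 * n - 1)) ∩
          slabConn k (boxR (-(7 * n)) (7 * n) 0 (13 * n - 1)) {z | z.2 = 0} (sideSeg (7 * n) (5 * n) (13 * n - 1))) ∩
        (slabConn k (boxR (-(7 * n)) (7 * n) 0 (13 * n - 1)) (sideSeg (7 * n) (5 * n) (13 * n - 1))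
          (sideSeg (7 * n) 0 (4 * n - 1)))ᶜ ∩ (evCase2 k ρ₂ n)ᶜ) ≤ M := by
  set E := case2Setup n hn with hE
  set P := bondPercolation (slabGraph 3 k) p with hP
  rw [preimage_reflect_case3 hn, real_preimage_slabRelabel k _ (planarAdj_planarReflect _)]
  -- the reflected event is contained in the event of `real_case3_le`
  have hsub : (slabConn k E.S {z | z.1 = 7 * n} E.A ∩ slabConn k E.R {z | z.2 = 0} E.C) ∩
        (E.Q.evCA k)ᶜ ∩ (E.Q.evAB k ∩ E.Q.evNear k ρ₂)ᶜ ⊆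
      E.Q.evAB k ∩ slabConn k E.Q.R {z | z.2 = 0} E.Q.C ∩ (E.Q.evCA k)ᶜ ∩ (E.Q.evAB k ∩ E.Q.evNear k ρ₂)ᶜ := by
    rintro ω ⟨⟨⟨hLA, hBC⟩, hCA⟩, hN⟩
    refine ⟨⟨⟨?_, hBC⟩, hCA⟩, hN⟩
    -- `{x = 7n} ⟷^{S'} A` is `A ⟷^{S'} B`
    have h1 : ω ∈ slabConn k E.S E.A {z | z ∈ E.S ∧ z ∈ ({z | z.1 = 7 * n} : Set (ℤ × ℤ))} :=
      slabConn_inter_right (slabConn_comm hLA)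
    have hB : {z | z ∈ E.S ∧ z ∈ ({z | z.1 = 7 * n} : Set (ℤ × ℤ))} = E.B := by
      ext z; rw [ExtSetup.mem_B_iff]; rfl
    rw [hB] at h1
    exact h1
  refine le_trans ?_ (E.Q.real_case3_le (k := k) (ρ := ρ₂) p {z | z.2 = 0} hM hbound)
  simp only [measureReal_def]
  exact ENNReal.toReal_mono (measure_ne_top _ _) (measure_mono hsub)

/-! ## `(H3)` from the gluing step `(H316)` -/

/-- **NTW 2017, Theorem 3.14, Case 3: `(H3)` follows from the exploration inequality and the gluing
step.** Let `(H316)` hold: for every `x > 0` there are `y > 0` and `n₃` such that for `n ≥ n₃`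
(`n ≥ 1`) and every lattice configuration `ω` of the reflected frame with `A ⟷^{S'} B`,
`𝖡 ⟷^{R'} C`, not `C ⟷^{R'} A`, not `C̄ ⟷^{R̄'} 𝒩(Γ̄, ρ₂)`:
`x ≤ P[C ⟷^{R' ∖ 𝒞(ω)} 𝖡]` implies `y ≤ f(14n, 13n)` (this is the topology of `γ ∪ γ'` together
with Lemma 3.16). Then `(H3)` of `thm314_of_case3` holds: `x ≤ P[𝒜 ∩ 𝓑₁ᶜ ∩ 𝓑₂ᶜ]` implies
`y' ≤ f(14n,13n)` eventually. [cite: NewmanTassionWu2017, §3.5 (proof of Theorem 3.14, Case 3, (3.47)–(3.52) with Lemma 3.16)] -/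
theorem thm314_hCase3_of {ρ₂ : ℕ} (p : unitInterval)
    (h316 : ∀ x : ℝ, 0 < x → ∃ y : ℝ, 0 < y ∧ ∃ n₃ : ℕ, ∀ n : ℕ, n₃ ≤ n → ∀ hn : 1 ≤ n,
      ∀ ω : BondConfig (slab 3 k), ω ⊆ (slabGraph 3 k).edgeSet →
      ω ∈ (case2Setup n hn).Q.evAB k → ω ∈ slabConn k (case2Setup n hn).R {z | z.2 = 0} (case2Setup n hn).C →
      ω ∉ (case2Setup n hn).Q.evCA k → ω ∉ (case2Setup n hn).Q.evNear k ρ₂ →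
      x ≤ (bondPercolation (slabGraph 3 k) p).real
        ((case2Setup n hn).Q.evOff k {z | z.2 = 0} ((case2Setup n hn).Q.explored k ρ₂ ω)) →
      y ≤ (bondPercolation (slabGraph 3 k) p).real
        (slabConn k (boxR 0 (14 * n) 0 (13 * n)) {z | z.1 = 0} {z | z.1 = 14 * n})) :
    ∀ x : ℝ, 0 < x → ∃ y : ℝ, 0 < y ∧ ∃ n₃ : ℕ, ∀ n : ℕ, n₃ ≤ n →
      x ≤ (bondPercolation (slabGraph 3 k) p).real
        ((slabConn k (boxR 0 (7 * n) 0 (8 * n - 1)) {z | z.1 = 0} (sideSeg (7 * n) 0 (4 * n - 1)) ∩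
            slabConn k (boxR (-(7 * n)) (7 * n) 0 (13 * n - 1)) {z | z.2 = 0} (sideSeg (7 * n) (5 * n) (13 * n - 1))) ∩
          (slabConn k (boxR (-(7 * n)) (7 * n) 0 (13 * n - 1)) (sideSeg (7 * n) (5 * n) (13 * n - 1))
            (sideSeg (7 * n) 0 (4 * n - 1)))ᶜ ∩ (evCase2 k ρ₂ n)ᶜ) →
      y ≤ (bondPercolation (slabGraph 3 k) p).real
        (slabConn k (boxR 0 (14 * n) 0 (13 * n)) {z | z.1 = 0} {z | z.1 = 14 * n}) := by
  intro x hx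
  obtain ⟨y, hy, n₃, h⟩ := h316 (x / 2) (half_pos hx)
  refine ⟨y, hy, max n₃ 1, fun n hn hxE => ?_⟩
  have hn₃ : n₃ ≤ n := le_trans (le_max_left _ _) hn
  have hn1 : 1 ≤ n := le_trans (le_max_right _ _) hn
  by_contra hlt
  rw [not_le] at hlt
  -- every admissible explored set has probability `< x/2`
  have hb := real_case3_event_le (k := k) (ρ₂ := ρ₂) hn1 p (le_of_lt (half_pos hx))
    fun ω hω hAB hBC hCA hN => ?_
  · linarith
  · by_contra hxl
    rw [not_le] at hxl
    exact absurd (h n hn₃ hn1 ω hω hAB hBC hCA hN hxl.le) (not_le.2 hlt)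

/-- **NTW 2017, Theorem 3.14 with Case 2 and the exploration of Case 3 discharged**: slab `S_k`
(`k ≥ 1`), `ρ ≥ 4`, `ρ₂ ≥ 2`, `0 < p < 1`, `0 < c₀ ≤ 1`; assume (3.38) and the gluing step
`(H316)` of Case 3 (see `thm314_hCase3_of`). Then `∃ c' > 0, ∀ m ≥ 1, c' ≤ f_p(2m, m)`.
[cite: NewmanTassionWu2017, Theorem 3.14 (proof, (3.39)–(3.54); Case 3 = (3.47)–(3.52), Lemma 3.16)] -/
theorem thm314_of_lemma316 (hk : 1 ≤ k) {ρ : ℕ} (hρ : 4 ≤ ρ) {ρ₂ : ℕ} (hρ₂ : 2 ≤ ρ₂) (p : unitInterval)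
    (hp0 : 0 < (p : ℝ)) (hp1 : (p : ℝ) < 1) {c₀ : ℝ} (hc₀ : 0 < c₀) (hc₁ : c₀ ≤ 1)
    (h338 : ∀ m : ℕ, 1 ≤ m → c₀ ≤ (bondPercolation (slabGraph 3 k) p).real
      (slabConn k (boxR 0 m 0 (2 * m)) {z | z.1 = 0} {z | z.1 = m}))
    (h316 : ∀ x : ℝ, 0 < x → ∃ y : ℝ, 0 < y ∧ ∃ n₃ : ℕ, ∀ n : ℕ, n₃ ≤ n → ∀ hn : 1 ≤ n,
      ∀ ω : BondConfig (slab 3 k), ω ⊆ (slabGraph 3 k).edgeSet →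
      ω ∈ (case2Setup n hn).Q.evAB k → ω ∈ slabConn k (case2Setup n hn).R {z | z.2 = 0} (case2Setup n hn).C →
      ω ∉ (case2Setup n hn).Q.evCA k → ω ∉ (case2Setup n hn).Q.evNear k ρ₂ →
      x ≤ (bondPercolation (slabGraph 3 k) p).real
        ((case2Setup n hn).Q.evOff k {z | z.2 = 0} ((case2Setup n hn).Q.explored k ρ₂ ω)) →
      y ≤ (bondPercolation (slabGraph 3 k) p).real
        (slabConn k (boxR 0 (14 * n) 0 (13 * n)) {z | z.1 = 0} {z | z.1 = 14 * n})) :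
    ∃ c' : ℝ, 0 < c' ∧ ∀ m : ℕ, 1 ≤ m → c' ≤ (bondPercolation (slabGraph 3 k) p).real
      (slabConn k (boxR 0 (2 * m) 0 m) {z | z.1 = 0} {z | z.1 = 2 * m}) :=
  thm314_of_case3 hk hρ hρ₂ p hp0 hp1 hc₀ hc₁ h338 (thm314_hCase3_of p h316)

end NTW17

end Literature.Probability.Percolation
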